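import Mathlib.CategoryTheory.Galois.Decomposition
import Mathlib.CategoryTheory.Subobject.Basic
import Mathlib.CategoryTheory.Comma.Over.Basic
import Mathlib.Logic.Small.Basic
import Mathlib.Data.Countable.Small
import Literature.AnabelianGeometry.Anabelioids.ExactFunctorProofs
import Literature.AnabelianGeometry.Anabelioids.GaloisImages
import Literature.AnabelianGeometry.Anabelioids.TerminalCoproductComponents
import HarnessLib

/-!
# Connected components of objects of a connected anabelioid ([SemiAnbd] Def. 2.2 (i), brick B4(b))

Mochizuki, *Semi-graphs of anabelioids*, Publ. RIMS **42** (2006), §2 p. 23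
[cite: MochizukiSemiAnbd2006, Def. 2.2(i) p.23]: for the finite étale covering `𝒢' → 𝒢` attached
to an object `{S_v, T_e, ψ_b}` of `B(𝒢)`, "the vertices (respectively, edges) of `𝔾'` that lie over
`v` (respectively, `e`) correspond to the connected components of `S_v` (respectively, `T_e`)", and a
branch of such an edge abuts to the vertex given by the component under which its component lies,
via `ψ_b`.  The cell renders the set of connected components of an object `X` of a connected
anabelioid (Galois category) as its connected subobjects (`π₀Obj X`, `GaloisCountableGraphs.lean`).
This proof-only file supplies the three facts about them the construction needs:

* `finite_subobject` — an object of a Galois category has finitely many subobjects (a subobject is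
  determined by the image of its fibre: `subobject_le_of_range_subset`), hence finitely many
  connected components (`finite_connectedSubobject`);
* `small_over` — the slice `Over P` is `u₁`-small (hom-sets of a Galois category are finite), so
  that the component anabelioid `(𝒢_v)_P` has a model in the universe of the constituents;
* `exists_connected_le_map_arrow` — **the component under**: for an exact `B : C ⥤ D` (a morphism
  of anabelioids `b_*`), an isomorphism `ψ : B S ≅ T` and a connected subobject `Q` of `T`, there is
  a connected subobject `P` of `S` with `Q ≤ ψ(B P)`, i.e. `Q ↪ T` factors through
  `B P ↪ B S ⥲ T` ([SGA1, Exp. V §4]: a point of the fibre lies in a connected component).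
-/

namespace Literature.AnabelianGeometry.Anabelioids

open CategoryTheory CategoryTheory.Limits CategoryTheory.PreGaloisCategory

universe w v₁ v₂ u₁ u₂

section Subobjects

variable {C : Type u₁} [Category.{v₁} C] [GaloisCategory C]

/-- A subobject of an object of a Galois category is determined by the image of its fibre: if the
fibre of `P ↪ X` lands inside the image of the fibre of `Q ↪ X`, then `P ≤ Q` (the projection
`P ×_X Q → P` is a monomorphism which is surjective on fibres, hence an isomorphism).
[cite: SGA1, Exp. V §4 (condition (G6))] -/
theorem subobject_le_of_range_subset (F : C ⥤ FintypeCat.{w}) [FiberFunctor F] {X : C}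
    (P Q : Subobject X) (h : Set.range (F.map P.arrow) ⊆ Set.range (F.map Q.arrow)) : P ≤ Q := by
  haveI : IsIso (pullback.fst P.arrow Q.arrow) := by
    refine isIso_of_mono_of_surjective_fiber F (pullback.fst P.arrow Q.arrow) fun p => ?_
    obtain ⟨q, hq⟩ := h ⟨p, rfl⟩
    exact ⟨(fiberPullbackEquiv F P.arrow Q.arrow).symm ⟨(p, q), hq.symm⟩,
      fiberPullbackEquiv_symm_fst_apply F p q hq.symm⟩
  refine Subobject.le_of_comm (inv (pullback.fst P.arrow Q.arrow) ≫ pullback.snd P.arrow Q.arrow) ?_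
  rw [Category.assoc, ← pullback.condition, IsIso.inv_hom_id_assoc]

/-- **An object of a Galois category has finitely many subobjects** (they inject into the subsets of
its finite fibre). [cite: SGA1, Exp. V §4 (condition (G6))] -/
theorem finite_subobject (X : C) : Finite (Subobject X) := by
  let F := GaloisCategory.getFiberFunctor C
  refine Finite.of_injective (fun P : Subobject X => Set.range (F.map P.arrow)) fun P Q hPQ => ?_
  exact le_antisymm (subobject_le_of_range_subset F P Q (le_of_eq hPQ))
    (subobject_le_of_range_subset F Q P (le_of_eq hPQ.symm))

/-- An object of a Galois category has finitely many connected components (connected subobjects).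
[cite: MochizukiSemiAnbd2006, Def. 2.2(i) p.23] -/
theorem finite_connectedSubobject (X : C) : Finite {P : Subobject X // IsConnected (P : C)} := by
  haveI := finite_subobject X
  exact Subtype.finite

/-- Hom-sets of a Galois category are finite (the fibre functor is faithful with finite values).
[cite: SGA1, Exp. V §4 (condition (G6))] -/
theorem finite_hom (Y X : C) : Finite (Y ⟶ X) := by
  let F := GaloisCategory.getFiberFunctor C
  exact Finite.of_injective (fun f : Y ⟶ X => F.map f) (Functor.map_injective F)

/-- **The slice over an object of a Galois category is small** in the universe of objects: an object
`Y → P` of `Over P` is a pair (object, one of finitely many arrows). Used to model the component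
anabelioid `(𝒢_v)_P` ([SemiAnbd] p. 23) in the universe of the constituents.
[cite: MochizukiSemiAnbd2006, Def. 2.2(i) p.23] -/
theorem small_over (P : C) : Small.{u₁} (Over P) := by
  haveI : ∀ Y : C, Small.{u₁} (Y ⟶ P) := fun Y => by
    haveI := finite_hom Y P
    infer_instance
  refine small_of_injective (β := Σ Y : C, Y ⟶ P) (f := fun A => ⟨A.left, A.hom⟩) ?_
  intro A B hAB
  obtain ⟨Al, ⟨⟨⟩⟩, Ah⟩ := A
  obtain ⟨Bl, ⟨⟨⟩⟩, Bh⟩ := B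
  obtain ⟨rfl, hh⟩ := Sigma.mk.inj_iff.mp hAB
  obtain rfl := heq_iff_eq.mp hh
  rfl

end Subobjects

/-! ### The component under a component, along an exact functor -/

section ComponentUnder

variable {C : Type u₁} [Category.{v₁} C] [GaloisCategory C]
  {D : Type u₂} [Category.{v₂} D] [GaloisCategory D]
  (B : C ⥤ D) [PreservesFiniteLimits B] [PreservesFiniteColimits B]

/-- **The component under** ([SemiAnbd] p. 23: a connected component of `T_e` lies, via `ψ_b`, under a
connected component of `S_v`): for an exact functor `B` between Galois categories, an isomorphism
`ψ : B S ≅ T` and a connected subobject `Q` of `T`, there is a connected subobject `P` of `S` such that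
`Q ↪ T` factors through `B P ↪ B S ⥲ T`.  (Take a point `q` of the fibre of `Q`; its image in the
fibre of `B S`, a fibre functor of `C` composed with `B`, lies in a connected component `P` of `S`;
then `Q ×_T B P → Q` is a monomorphism with nonempty fibre into a connected object, an isomorphism.)
[cite: MochizukiSemiAnbd2006, Def. 2.2(i) p.23] -/
theorem exists_connected_le_map_arrow {S : C} {T : D} (ψ : B.obj S ≅ T) (Q : Subobject T)
    [IsConnected (Q : D)] :
    ∃ P : Subobject S, IsConnected (P : C) ∧ ∃ f : (Q : D) ⟶ B.obj (P : C),
      f ≫ B.map P.arrow ≫ ψ.hom = Q.arrow := by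
  let F := GaloisCategory.getFiberFunctor D
  haveI : FiberFunctor (B ⋙ F) := fiberFunctor_comp_of_exact B F
  -- a point of the fibre of `Q` and its image in the fibre of `B S`
  obtain ⟨q⟩ := nonempty_fiber_of_isConnected F (Q : D)
  let s : (B ⋙ F).obj S := F.map ψ.inv (F.map Q.arrow q)
  -- the connected component of `S` containing `s`
  obtain ⟨Y, i, y, hy, hY, hi⟩ := fiber_in_connected_component (B ⋙ F) S s
  refine ⟨Subobject.mk i, ?_, ?_⟩
  · haveI := hY
    exact isConnected_of_iso (Subobject.underlyingIso i).symm
  · -- `Q ×_T B(mk i) → Q` is an isomorphism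
    let g : B.obj (Subobject.mk i : C) ⟶ T := B.map (Subobject.mk i).arrow ≫ ψ.hom
    let y' : F.obj (B.obj (Subobject.mk i : C)) := F.map (B.map (Subobject.underlyingIso i).inv) y
    have hBi : B.map (Subobject.underlyingIso i).inv ≫ B.map (Subobject.mk i).arrow = B.map i := by
      rw [← B.map_comp, Subobject.underlyingIso_arrow]
    have h1 : F.map (B.map i) y = s := hy
    have hpt : F.map Q.arrow q = F.map g y' := by
      change F.map Q.arrow q = F.map (B.map (Subobject.mk i).arrow ≫ ψ.hom)
        (F.map (B.map (Subobject.underlyingIso i).inv) y)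
      rw [← FintypeCat.comp_apply (F.map _) (F.map _) y, ← F.map_comp, ← Category.assoc, hBi,
        F.map_comp, FintypeCat.comp_apply, h1]
      change F.map Q.arrow q = F.map ψ.hom (F.map ψ.inv (F.map Q.arrow q))
      rw [← FintypeCat.comp_apply (F.map ψ.inv) (F.map ψ.hom), ← F.map_comp, Iso.inv_hom_id,
        F.map_id, FintypeCat.id_apply]
    let r : F.obj (pullback Q.arrow g) := (fiberPullbackEquiv F Q.arrow g).symm ⟨(q, y'), hpt⟩
    haveI : IsIso (pullback.fst Q.arrow g) :=
      IsConnected.noTrivialComponent _ (pullback.fst Q.arrow g) (not_initial_of_inhabited F r)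
    refine ⟨inv (pullback.fst Q.arrow g) ≫ pullback.snd Q.arrow g, ?_⟩
    change (inv (pullback.fst Q.arrow g) ≫ pullback.snd Q.arrow g) ≫ g = Q.arrow
    rw [Category.assoc, ← pullback.condition, IsIso.inv_hom_id_assoc]

end ComponentUnder

end Literature.AnabelianGeometry.Anabelioids
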